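import Summits.SmoothPoincare4.SmoothPoincare4.Theorems.CongruenceShadowsShadowApproximationEpiClassLivingstonDefs
import Literature.Algebra.Lie.SurfaceLieAlgebra
import Literature.GroupTheory.CombinatorialGroupTheory.FreeGroupRebasing
import HarnessLib

/-!
# Stub `stub_rebasing` of line `free-shadow-tsystem` for crux `CongruenceShadows.ShadowApproximation`
(item stmt-SmoothPoincare4-14595, route route-SmoothPoincare4-CongruenceShadows) — re-basing: T⁺ ⟹ Nielsen-standard

Notation (line card `Cruxes/ShadowApproximation/Lines/free-shadow-tsystem.md`): `S = SurfaceGroup (3+3m)`,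
`N = s4Kernels.stabilizeIter m` (block `j` of `N 0 / N 1 / N 2` kills `{a_{3j},a_{3j+1},b_{3j+2}} /
{a_{3j},b_{3j+1},a_{3j+2}} / {b_{3j},a_{3j+1},a_{3j+2}}`: `N i = ⟪s4CutSystem m i⟫`, the cut normal form, re-derived
inside the proof (§0) exactly as in `Theorems/CongruenceShadowsNilpotentShadowsStandardStubCutNormalForm.lean` of the
sibling crux `NilpotentShadowsStandard`, whose module is not imported here), `F = S ⧸ N 0 = π₁(H₀)`,
`π = QuotientGroup.mk' (N 0)`,
`Ū = π(N 1)`, `V̄_N = π(N 2)`, `B̄_V = π⟨b_{3j}, a_{3j+2}⟩`.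

**`stub_rebasing`** (registered, proved verbatim): for every `θ₀ ∈ Aut F` with `θ₀(B̄_V) ⊔ Ū = ⊤`
(T⁺ for the free factor `A = θ₀(B̄_V)`) there is `θ ∈ Aut F` with `θ(Ū) = Ū` and `θ(V̄_N) = θ₀(V̄_N)`.

Proof.  §1 `F` is free on the surviving letters `b_{3j}, b_{3j+1}, a_{3j+2}`: killing the cut system
`C₀ = s4CutSystem m 0` (which meets every handle) leaves the free group on its complement
(`quotientEquivFreeGroupErase`, with `N 0 = ⟪C₀⟫` from the cut normal form); call the isomorphism
`eF : F ≃* F(ι)`, `ι = {x ∉ C₀}`.  §2 Colour a surviving letter by the residue of its handle mod `3`,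
`c : ι → Fin 3` (`b_{3j} ↦ 0`, `b_{3j+1} ↦ 1`, `a_{3j+2} ↦ 2`); then `eF(Ū) = ⟪c ≠ 0⟫`,
`eF(V̄_N) = ⟪c ≠ 1⟫`, `eF(B̄_V) = ⟨c ≠ 1⟩` (the killed letters of `N 1`, `N 2` that survive `N 0`, a
finite pattern check on `s4Gens`, and `π(x) ↦ 1` for the others).  §3 Transport along `eF` and apply the
free-group **re-basing lemma** `Literature.GroupTheory.CombinatorialGroupTheory.exists_mulEquiv_map_normalClosure_eq`
(Nielsen normal form of the generating tuple `(θ₀ z mod U)_{z ∈ X ∪ T}` of `F ⧸ U ≅ F_k`, Lyndon–Schupp I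
Prop. 2.7, `NielsenGeneratingTuples*.lean`; then a transvection of the complement into `U`; `θ(U) = U`
because `φ_U ∘ θ = φ_U`, no Hopficity needed).  No new definitions, no named facts.
-/

-- the prescribed namespace `Summit.<P>.<Sub>.…` duplicates `SmoothPoincare4` (P = Sub)
set_option linter.dupNamespace false
noncomputable section
open Literature.Topology.FourManifolds Literature.GroupTheory.CombinatorialGroupTheory Literature.Algebra.Lie

namespace Summit.SmoothPoincare4.SmoothPoincare4.Theorems.ShadowApproximation.FreeShadowTsystem

/-! ## The stub -/

/-- **Stub `stub_rebasing`** (line `free-shadow-tsystem`, §4 of the skeleton; triage r1-1 "checked on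
paper"): in `F = S ⧸ N 0` with `Ū = π(N 1)`, `V̄_N = π(N 2)`, `B̄_V = π⟨b_{3j}, a_{3j+2}⟩`, every
`θ₀ ∈ Aut F` with `θ₀(B̄_V) ⊔ Ū = ⊤` can be replaced by `θ ∈ Aut F` with `θ(Ū) = Ū` and
`θ(V̄_N) = θ₀(V̄_N)`.  Known-type mathematics (Nielsen 1924; Lyndon–Schupp I Prop. 2.7: a generating
tuple of `F_k` is Nielsen equivalent to a basis padded with `1`'s), proved here via the free-group re-basing
lemma `exists_mulEquiv_map_normalClosure_eq` transported along `S ⧸ N 0 ≅ F⟨b_{3j}, b_{3j+1}, a_{3j+2}⟩`.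
[cite: LyndonSchupp2001, Ch. I Prop. 2.7] -/
theorem stub_rebasing :
    ∀ (m : ℕ) (θ₀ : (SurfaceGroup (3 + 3 * m) ⧸ s4Kernels.stabilizeIter m 0) ≃*
        (SurfaceGroup (3 + 3 * m) ⧸ s4Kernels.stabilizeIter m 0)),
      ((Subgroup.closure
            (Set.range (fun j : Fin (m + 1) =>
                SurfaceGroup.b (⟨3 * (j : ℕ), by omega⟩ : Fin (3 + 3 * m))) ∪
              Set.range (fun j : Fin (m + 1) =>
                SurfaceGroup.a (⟨3 * (j : ℕ) + 2, by omega⟩ : Fin (3 + 3 * m))))).map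
            (QuotientGroup.mk' (s4Kernels.stabilizeIter m 0))).map θ₀.toMonoidHom ⊔
          (s4Kernels.stabilizeIter m 1).map (QuotientGroup.mk' (s4Kernels.stabilizeIter m 0)) = ⊤ →
      ∃ θ : (SurfaceGroup (3 + 3 * m) ⧸ s4Kernels.stabilizeIter m 0) ≃*
          (SurfaceGroup (3 + 3 * m) ⧸ s4Kernels.stabilizeIter m 0),
        ((s4Kernels.stabilizeIter m 1).map (QuotientGroup.mk' (s4Kernels.stabilizeIter m 0))).map
            θ.toMonoidHom =
          (s4Kernels.stabilizeIter m 1).map (QuotientGroup.mk' (s4Kernels.stabilizeIter m 0)) ∧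
        ((s4Kernels.stabilizeIter m 2).map (QuotientGroup.mk' (s4Kernels.stabilizeIter m 0))).map
            θ.toMonoidHom =
          ((s4Kernels.stabilizeIter m 2).map (QuotientGroup.mk' (s4Kernels.stabilizeIter m 0))).map
            θ₀.toMonoidHom := by
  intro m θ₀ hT
  classical
  /- §0 transport of subgroups along isomorphisms -/
  have map_map_symm' : ∀ {G H : Type} [Group G] [Group H] (e : G ≃* H) (L : Subgroup G),
      (L.map e.toMonoidHom).map e.symm.toMonoidHom = L := by
    intro G H _ _ e L
    rw [Subgroup.map_map]
    have : e.symm.toMonoidHom.comp e.toMonoidHom = MonoidHom.id G :=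
      MonoidHom.ext fun x => e.symm_apply_apply x
    rw [this, Subgroup.map_id]
  have map_trans' : ∀ {G H K : Type} [Group G] [Group H] [Group K] (e₁ : G ≃* H) (e₂ : H ≃* K)
      (L : Subgroup G),
      L.map (e₁.trans e₂).toMonoidHom = (L.map e₁.toMonoidHom).map e₂.toMonoidHom := by
    intro G H K _ _ _ e₁ e₂ L
    rw [Subgroup.map_map]
    rfl
  /- §0 the cut normal form `N i = ⟪s4CutSystem m i⟫` (adapted from the sibling crux's
    `Theorems/CongruenceShadowsNilpotentShadowsStandardStubCutNormalForm.lean`, not imported) -/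
  -- a hom out of the free group killing one letter of every handle kills the surface relator
  have cut_relator : ∀ {n : ℕ} {T : Type} [Group T] (Φ : FreeGroup (surfaceGen n) →* T),
      (∀ j : Fin n, Φ (genA j) = 1 ∨ Φ (genB j) = 1) → Φ (surfaceRelator n) = 1 := by
    intro n T _ Φ hgen
    unfold surfaceRelator
    rw [map_list_prod, List.map_map]
    refine List.prod_eq_one fun y hy => ?_
    obtain ⟨j, -, rfl⟩ := List.mem_map.1 hy
    rcases hgen j with h | h <;> simp [h]
  -- letter transfer along a handle relabelling `f`, modulo a normal subgroup meeting every handle `f j`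
  have cut_transfer : ∀ {n k : ℕ} (f : Fin n → Fin k) (C : Set (surfaceGen n))
      (N : Subgroup (SurfaceGroup k)) [N.Normal],
      (∀ j : Fin n, (PresentedGroup.of (f j, false) : SurfaceGroup k) ∈ N ∨
        (PresentedGroup.of (f j, true) : SurfaceGroup k) ∈ N) →
      (∀ p ∈ C, (PresentedGroup.of (f p.1, p.2) : SurfaceGroup k) ∈ N) →
      ∀ x : FreeGroup (surfaceGen n),
        PresentedGroup.mk _ x ∈ Subgroup.normalClosure (PresentedGroup.of '' C : Set (SurfaceGroup n)) →
        PresentedGroup.mk _ (FreeGroup.map (fun p : surfaceGen n => (f p.1, p.2)) x) ∈ N := by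
    intro n k f C N _ hN hC x hx
    set Φ : FreeGroup (surfaceGen n) →* SurfaceGroup k ⧸ N :=
      (QuotientGroup.mk' N).comp ((PresentedGroup.mk _).comp
        (FreeGroup.map fun p : surfaceGen n => (f p.1, p.2))) with hΦ
    have hΦof : ∀ p : surfaceGen n, Φ (FreeGroup.of p) = 1 ↔
        (PresentedGroup.of (f p.1, p.2) : SurfaceGroup k) ∈ N := by
      intro p
      rw [hΦ, MonoidHom.comp_apply, MonoidHom.comp_apply, FreeGroup.map.of, QuotientGroup.mk'_apply,
        QuotientGroup.eq_one_iff]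
      rfl
    have hrel : ∀ r ∈ ({surfaceRelator n} : Set (FreeGroup (surfaceGen n))), Φ r = 1 := by
      intro r hr
      rw [Set.mem_singleton_iff] at hr
      rw [hr]
      exact cut_relator Φ fun j => (hN j).imp (hΦof (j, false)).2 (hΦof (j, true)).2
    have hker : Subgroup.normalClosure (PresentedGroup.of '' C : Set (SurfaceGroup n)) ≤
        (presentedLift Φ hrel).ker := by
      refine Subgroup.normalClosure_le_normal ?_
      rintro _ ⟨p, hp, rfl⟩
      rw [SetLike.mem_coe, MonoidHom.mem_ker, presentedLift_of]
      exact (hΦof p).2 (hC p hp)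
    have h := hker hx
    rw [MonoidHom.mem_ker, presentedLift_mk, hΦ, MonoidHom.comp_apply, MonoidHom.comp_apply,
      QuotientGroup.mk'_apply, QuotientGroup.eq_one_iff] at h
    exact h
  -- one stabilisation step in cut normal form
  have cut_step : ∀ {g : ℕ} (C : Set (surfaceGen g)) (C₃ : Set (surfaceGen 3))
      (C' : Set (surfaceGen (g + 3))),
      (∀ p ∈ C, (Fin.castAdd 3 p.1, p.2) ∈ C') →
      (∀ p ∈ C₃, (Fin.natAdd g p.1, p.2) ∈ C') →
      (∀ q ∈ C', (∃ p ∈ C, (Fin.castAdd 3 p.1, p.2) = q) ∨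
        (∃ p ∈ C₃, (Fin.natAdd g p.1, p.2) = q)) →
      (∀ j : Fin (g + 3), (j, false) ∈ C' ∨ (j, true) ∈ C') →
      Subgroup.normalClosure (stabSet
          (↑(Subgroup.normalClosure (PresentedGroup.of '' C : Set (SurfaceGroup g))))
          (↑(Subgroup.normalClosure (PresentedGroup.of '' C₃ : Set (SurfaceGroup 3))))) =
        Subgroup.normalClosure (PresentedGroup.of '' C' : Set (SurfaceGroup (g + 3))) := by
    intro g C C₃ C' ha hb hc hd
    have hN : ∀ q ∈ C', (PresentedGroup.of q : SurfaceGroup (g + 3)) ∈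
        Subgroup.normalClosure (PresentedGroup.of '' C' : Set (SurfaceGroup (g + 3))) :=
      fun q hq => Subgroup.subset_normalClosure ⟨q, hq, rfl⟩
    apply le_antisymm
    · refine Subgroup.normalClosure_le_normal ?_
      rintro s (⟨x, hx, rfl⟩ | ⟨x, hx, rfl⟩)
      · exact cut_transfer (Fin.castAdd 3) C _
          (fun j => (hd (Fin.castAdd 3 j)).imp (hN _) (hN _)) (fun p hp => hN _ (ha p hp)) x hx
      · exact cut_transfer (Fin.natAdd g) C₃ _
          (fun j => (hd (Fin.natAdd g j)).imp (hN _) (hN _)) (fun p hp => hN _ (hb p hp)) x hx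
    · refine Subgroup.normalClosure_mono ?_
      rintro _ ⟨q, hq, rfl⟩
      rcases hc q hq with ⟨p, hp, rfl⟩ | ⟨p, hp, rfl⟩
      · refine Or.inl ⟨FreeGroup.of p, Subgroup.subset_normalClosure ⟨p, hp, rfl⟩, ?_⟩
        simp only [Function.comp_apply, genIncl_of]
        rfl
      · refine Or.inr ⟨FreeGroup.of p, Subgroup.subset_normalClosure ⟨p, hp, rfl⟩, ?_⟩
        simp only [Function.comp_apply, genShift_of]
        rfl
  -- a letter shifted to the last three handles keeps its pattern (`(3 + 3m' + j) mod 3 = j`)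
  have natAdd_mem : ∀ (m' : ℕ) (i j : Fin 3) (b : Bool),
      (Fin.natAdd (3 + 3 * m') j, b) ∈ (s4CutSystem (m' + 1) i : Set (surfaceGen (3 + 3 * m' + 3))) ↔
        (j, b) ∈ s4Gens i := by
    intro m' i j b
    have hj : (3 + 3 * m' + (j : ℕ)) % 3 = j := by have := j.is_lt; omega
    show ((⟨((Fin.natAdd (3 + 3 * m') j : Fin (3 + 3 * m' + 3)) : ℕ) % 3, Nat.mod_lt _ (by decide)⟩ :
        Fin 3), b) ∈ s4Gens i ↔ _
    simp only [Fin.val_natAdd, hj, Fin.eta]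
  -- the cut normal form, by induction on the number of stabilisations
  have hNall : ∀ (m' : ℕ) (i : Fin 3),
      s4Kernels.stabilizeIter m' i = Subgroup.normalClosure (PresentedGroup.of '' s4CutSystem m' i) := by
    intro m' i
    induction m' with
    | zero =>
      rw [s4CutSystem_zero]
      exact s4Kernels_eq i
    | succ m' ih =>
      change (s4Kernels.stabilizeIter m').stabilize i = _
      rw [TrisectionKernels.stabilize_apply, ih, s4Kernels_eq]
      refine cut_step (s4CutSystem m' i) ↑(s4Gens i) (s4CutSystem (m' + 1) i) ?_ ?_ ?_ ?_
      · intro p hp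
        exact hp
      · intro p hp
        exact (natAdd_mem m' i p.1 p.2).2 hp
      · rintro ⟨j, b⟩ hq
        induction j using Fin.addCases with
        | left j => exact Or.inl ⟨(j, b), hq, rfl⟩
        | right j => exact Or.inr ⟨(j, b), (natAdd_mem m' i j b).1 hq, rfl⟩
      · exact fun j => s4Gens_hits i _
  have hN : ∀ i, s4Kernels.stabilizeIter m i =
      Subgroup.normalClosure (PresentedGroup.of '' Literature.Algebra.Lie.s4CutSystem m i) :=
    hNall m
  /- §1 `F = S ⧸ N 0` is free on the letters outside the cut system `C₀` -/
  set C0 : Finset (surfaceGen (3 + 3 * m)) :=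
    Finset.univ.filter (fun x => x ∈ Literature.Algebra.Lie.s4CutSystem m 0) with hC0
  have hmemC0 : ∀ x, x ∈ C0 ↔ x ∈ Literature.Algebra.Lie.s4CutSystem m 0 := fun x => by
    simp [hC0]
  have hmem_cut : ∀ (i : Fin 3) (x : surfaceGen (3 + 3 * m)),
      x ∈ Literature.Algebra.Lie.s4CutSystem m i ↔
        ((⟨(x.1 : ℕ) % 3, Nat.mod_lt _ (by decide)⟩ : Fin 3), x.2) ∈ s4Gens i :=
    fun i x => Iff.rfl
  have hhit : ∀ i : Fin (3 + 3 * m), (i, false) ∈ C0 ∨ (i, true) ∈ C0 := by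
    intro i
    rw [hmemC0, hmemC0, hmem_cut, hmem_cut]
    exact s4Gens_hits 0 _
  have hN₁ : ∀ x ∈ C0, (PresentedGroup.of x : SurfaceGroup (3 + 3 * m)) ∈
      s4Kernels.stabilizeIter m 0 := by
    intro x hx
    rw [hN]
    exact Subgroup.subset_normalClosure ⟨x, (hmemC0 x).1 hx, rfl⟩
  have hN₂ : s4Kernels.stabilizeIter m 0 ≤ (eraseHom C0 hhit).ker := by
    rw [hN]
    refine Subgroup.normalClosure_le_normal ?_
    rintro _ ⟨x, hx, rfl⟩
    exact of_mem_ker_eraseHom C0 hhit ((hmemC0 x).2 hx)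
  set eF := quotientEquivFreeGroupErase C0 hhit (s4Kernels.stabilizeIter m 0) hN₁ hN₂ with heF
  set π := QuotientGroup.mk' (s4Kernels.stabilizeIter m 0) with hπ
  have hsurj : Function.Surjective (eF.toMonoidHom.comp π) :=
    eF.surjective.comp (QuotientGroup.mk'_surjective _)
  have heπ : ∀ x, eF (π (PresentedGroup.of x)) = eraseGen C0 x := by
    intro x
    show QuotientGroup.lift (s4Kernels.stabilizeIter m 0) (eraseHom C0 hhit) hN₂
      (QuotientGroup.mk (PresentedGroup.of x)) = eraseGen C0 x
    rw [QuotientGroup.lift_mk, eraseHom_of]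
  have hbgen : ∀ i : Fin (3 + 3 * m), SurfaceGroup.b i = PresentedGroup.of (i, true) := fun i => rfl
  have hagen : ∀ i : Fin (3 + 3 * m), SurfaceGroup.a i = PresentedGroup.of (i, false) := fun i => rfl
  /- §2 colour the surviving letters by the residue of their handle mod 3 -/
  set c : {x // x ∉ C0} → Fin 3 := fun z => ⟨((z.1.1 : ℕ)) % 3, Nat.mod_lt _ (by decide)⟩ with hc
  have hcval : ∀ z, ((c z : Fin 3) : ℕ) = (z.1.1 : ℕ) % 3 := fun z => rfl
  have hz_cut : ∀ (z : {x // x ∉ C0}) (i : Fin 3),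
      z.1 ∈ Literature.Algebra.Lie.s4CutSystem m i ↔ (c z, z.1.2) ∈ s4Gens i := fun z i => Iff.rfl
  have hz0 : ∀ z : {x // x ∉ C0}, (c z, z.1.2) ∉ s4Gens 0 := fun z h =>
    z.2 ((hmemC0 _).2 ((hz_cut z 0).2 h))
  have pat : ∀ r : Fin 3, ∀ s : Bool, (r, s) ∉ s4Gens 0 →
      ((r, s) ∈ s4Gens 1 ↔ r ≠ 0) ∧ ((r, s) ∈ s4Gens 2 ↔ r ≠ 1) ∧
      (r ≠ 1 → ((r : ℕ) = 0 ∧ s = true) ∨ ((r : ℕ) = 2 ∧ s = false)) := by decide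
  have pat0 : ∀ r : Fin 3, (r : ℕ) = 0 → (r, true) ∉ s4Gens 0 ∧ r ≠ 1 := by decide
  have pat2 : ∀ r : Fin 3, (r : ℕ) = 2 → (r, false) ∉ s4Gens 0 ∧ r ≠ 1 := by decide
  /- the images of `Ū`, `V̄_N`, `B̄_V` in the free group -/
  have hNC : ∀ C : Set (surfaceGen (3 + 3 * m)),
      ((Subgroup.normalClosure (PresentedGroup.of '' C)).map π).map eF.toMonoidHom =
        Subgroup.normalClosure (FreeGroup.of '' {z : {x // x ∉ C0} | z.1 ∈ C}) := by
    intro C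
    rw [Subgroup.map_map, Subgroup.map_normalClosure _ _ hsurj]
    apply le_antisymm
    · refine Subgroup.normalClosure_le_normal ?_
      rintro _ ⟨_, ⟨x, hx, rfl⟩, rfl⟩
      rw [SetLike.mem_coe, MonoidHom.comp_apply, MulEquiv.coe_toMonoidHom, heπ]
      by_cases hx0 : x ∈ C0
      · rw [eraseGen_of_mem hx0]
        exact one_mem _
      · rw [eraseGen_of_not_mem hx0]
        exact Subgroup.subset_normalClosure ⟨⟨x, hx0⟩, hx, rfl⟩
    · refine Subgroup.normalClosure_mono ?_
      rintro _ ⟨z, hz, rfl⟩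
      refine ⟨PresentedGroup.of z.1, ⟨z.1, hz, rfl⟩, ?_⟩
      rw [MonoidHom.comp_apply, MulEquiv.coe_toMonoidHom, heπ, eraseGen_of_not_mem z.2]
  have hsetU : {z : {x // x ∉ C0} | z.1 ∈ Literature.Algebra.Lie.s4CutSystem m 1} = {z | c z ≠ 0} := by
    ext z
    simp only [Set.mem_setOf_eq]
    rw [hz_cut]
    exact (pat _ _ (hz0 z)).1
  have hsetV : {z : {x // x ∉ C0} | z.1 ∈ Literature.Algebra.Lie.s4CutSystem m 2} = {z | c z ≠ 1} := by
    ext z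
    simp only [Set.mem_setOf_eq]
    rw [hz_cut]
    exact (pat _ _ (hz0 z)).2.1
  have hU' : ((s4Kernels.stabilizeIter m 1).map π).map eF.toMonoidHom =
      Subgroup.normalClosure (FreeGroup.of '' {z | c z ≠ 0}) := by
    rw [hN 1, hNC, hsetU]
  have hV' : ((s4Kernels.stabilizeIter m 2).map π).map eF.toMonoidHom =
      Subgroup.normalClosure (FreeGroup.of '' {z | c z ≠ 1}) := by
    rw [hN 2, hNC, hsetV]
  have hsetB : (eF.toMonoidHom.comp π) ''
      (Set.range (fun j : Fin (m + 1) =>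
          SurfaceGroup.b (⟨3 * (j : ℕ), by omega⟩ : Fin (3 + 3 * m))) ∪
        Set.range (fun j : Fin (m + 1) =>
          SurfaceGroup.a (⟨3 * (j : ℕ) + 2, by omega⟩ : Fin (3 + 3 * m)))) =
      FreeGroup.of '' {z | c z ≠ 1} := by
    ext y
    constructor
    · rintro ⟨_, hs | hs, rfl⟩
      · obtain ⟨j, rfl⟩ := hs
        have hx := pat0 ⟨3 * (j : ℕ) % 3, Nat.mod_lt _ (by decide)⟩
          (by show 3 * (j : ℕ) % 3 = 0; omega)
        have hx0 : ((⟨3 * (j : ℕ), by omega⟩ : Fin (3 + 3 * m)), true) ∉ C0 := by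
          rw [hmemC0, hmem_cut]
          exact hx.1
        refine ⟨⟨_, hx0⟩, hx.2, ?_⟩
        dsimp only
        rw [MonoidHom.comp_apply, MulEquiv.coe_toMonoidHom, hbgen, heπ,
          eraseGen_of_not_mem hx0]
      · obtain ⟨j, rfl⟩ := hs
        have hx := pat2 ⟨(3 * (j : ℕ) + 2) % 3, Nat.mod_lt _ (by decide)⟩
          (by show (3 * (j : ℕ) + 2) % 3 = 2; omega)
        have hx0 : ((⟨3 * (j : ℕ) + 2, by omega⟩ : Fin (3 + 3 * m)), false) ∉ C0 := by
          rw [hmemC0, hmem_cut]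
          exact hx.1
        refine ⟨⟨_, hx0⟩, hx.2, ?_⟩
        dsimp only
        rw [MonoidHom.comp_apply, MulEquiv.coe_toMonoidHom, hagen, heπ,
          eraseGen_of_not_mem hx0]
    · rintro ⟨z, hz, rfl⟩
      have hlt : (z.1.1 : ℕ) < 3 + 3 * m := z.1.1.isLt
      rcases (pat _ _ (hz0 z)).2.2 hz with ⟨hr, hs⟩ | ⟨hr, hs⟩
      · rw [hcval] at hr
        have hx : (((⟨3 * ((z.1.1 : ℕ) / 3), by omega⟩ : Fin (3 + 3 * m)), true) :
            surfaceGen (3 + 3 * m)) = z.1 :=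
          Prod.ext (Fin.ext (by show 3 * ((z.1.1 : ℕ) / 3) = z.1.1; omega)) hs.symm
        refine ⟨SurfaceGroup.b ⟨3 * ((z.1.1 : ℕ) / 3), by omega⟩,
          Or.inl ⟨⟨(z.1.1 : ℕ) / 3, by omega⟩, rfl⟩, ?_⟩
        rw [MonoidHom.comp_apply, MulEquiv.coe_toMonoidHom, hbgen, hx, heπ,
          eraseGen_of_not_mem z.2]
      · rw [hcval] at hr
        have hx : (((⟨3 * ((z.1.1 : ℕ) / 3) + 2, by omega⟩ : Fin (3 + 3 * m)), false) :
            surfaceGen (3 + 3 * m)) = z.1 :=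
          Prod.ext (Fin.ext (by show 3 * ((z.1.1 : ℕ) / 3) + 2 = z.1.1; omega)) hs.symm
        refine ⟨SurfaceGroup.a ⟨3 * ((z.1.1 : ℕ) / 3) + 2, by omega⟩,
          Or.inr ⟨⟨(z.1.1 : ℕ) / 3, by omega⟩, rfl⟩, ?_⟩
        rw [MonoidHom.comp_apply, MulEquiv.coe_toMonoidHom, hagen, hx, heπ,
          eraseGen_of_not_mem z.2]
  have hB' : ((Subgroup.closure
      (Set.range (fun j : Fin (m + 1) =>
          SurfaceGroup.b (⟨3 * (j : ℕ), by omega⟩ : Fin (3 + 3 * m))) ∪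
        Set.range (fun j : Fin (m + 1) =>
          SurfaceGroup.a (⟨3 * (j : ℕ) + 2, by omega⟩ : Fin (3 + 3 * m))))).map π).map
        eF.toMonoidHom = Subgroup.closure (FreeGroup.of '' {z | c z ≠ 1}) := by
    rw [Subgroup.map_map, MonoidHom.map_closure, hsetB]
  /- §3 transport along `eF` and re-base in the free group -/
  set θ₀' : FreeGroup {x // x ∉ C0} ≃* FreeGroup {x // x ∉ C0} := eF.symm.trans (θ₀.trans eF)
    with hθ₀'
  have hT' : (Subgroup.closure (FreeGroup.of '' {z | c z ≠ 1})).map θ₀'.toMonoidHom ⊔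
      Subgroup.normalClosure (FreeGroup.of '' {z | c z ≠ 0}) = ⊤ := by
    rw [← hB', ← hU', hθ₀', map_trans', map_trans', map_map_symm',
      ← Subgroup.map_sup, hT, ← MonoidHom.range_eq_map,
      MonoidHom.range_eq_top.2 (show Function.Surjective eF.toMonoidHom from eF.surjective)]
  obtain ⟨θ', hθ'U, hθ'V⟩ := exists_mulEquiv_map_normalClosure_eq c θ₀' hT'
  refine ⟨eF.trans (θ'.trans eF.symm), ?_, ?_⟩
  · rw [map_trans', map_trans', hU', hθ'U, ← hU', map_map_symm']
  · rw [map_trans', map_trans', hV', hθ'V, hθ₀', map_trans',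
      map_trans', map_map_symm', ← hV', map_map_symm']

end Summit.SmoothPoincare4.SmoothPoincare4.Theorems.ShadowApproximation.FreeShadowTsystem

end
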